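import Literature.NumberTheory.LFunctions.WeilFirstPrimeOddMarginDataB
import Literature.NumberTheory.LFunctions.WeilBlockRows
import HarnessLib

/-!
# Odd-sector margin certificate B: dominance of rows 20–24 of `R = S'_odd(κ') − UᵀU`

Part of the odd-block check of `weilCertOddB` (`WeilFirstPrimeOddMarginDataB.lean`), evaluated by `decide +kernel`
row by row (`WeilCert.checkDomRow`, `WeilBlockRows.lean`) and kept in its own file for kernel time and memory.
Assembled in `WeilFirstPrimeOddMarginBCheck.lean`. Pure proof file; nothing is asserted.
-/

noncomputable section

namespace Literature.NumberTheory.LFunctions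

set_option maxHeartbeats 0 in
/-- Kernel check of the dominance of row 20 of `R = S'_odd(κ') − UᵀU` (certificate B). [folklore] -/
theorem checkDomRow1_20_weilCertOddB :
    weilCertOddB.base.checkDomRow weilCertOddB.nuTab weilCertOddBKappa' 1 20 = true := by
  decide +kernel

set_option maxHeartbeats 0 in
/-- Kernel check of the dominance of row 21 of `R = S'_odd(κ') − UᵀU` (certificate B). [folklore] -/
theorem checkDomRow1_21_weilCertOddB :
    weilCertOddB.base.checkDomRow weilCertOddB.nuTab weilCertOddBKappa' 1 21 = true := by
  decide +kernel

set_option maxHeartbeats 0 in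
/-- Kernel check of the dominance of row 22 of `R = S'_odd(κ') − UᵀU` (certificate B). [folklore] -/
theorem checkDomRow1_22_weilCertOddB :
    weilCertOddB.base.checkDomRow weilCertOddB.nuTab weilCertOddBKappa' 1 22 = true := by
  decide +kernel

set_option maxHeartbeats 0 in
/-- Kernel check of the dominance of row 23 of `R = S'_odd(κ') − UᵀU` (certificate B). [folklore] -/
theorem checkDomRow1_23_weilCertOddB :
    weilCertOddB.base.checkDomRow weilCertOddB.nuTab weilCertOddBKappa' 1 23 = true := by
  decide +kernel

set_option maxHeartbeats 0 in
/-- Kernel check of the dominance of row 24 of `R = S'_odd(κ') − UᵀU` (certificate B). [folklore] -/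
theorem checkDomRow1_24_weilCertOddB :
    weilCertOddB.base.checkDomRow weilCertOddB.nuTab weilCertOddBKappa' 1 24 = true := by
  decide +kernel

end Literature.NumberTheory.LFunctions
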